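import Literature.Computability.Complexity.PrivateCoinGamesParallel
import Literature.Computability.Complexity.InteractiveProofValues
import Literature.Computability.Complexity.ArthurMerlinBoards
import Literature.Computability.Complexity.StackBricksStrings
import HarnessLib

/-!
# Interactive proofs: the parallel-repetition verifier and error reduction for `IP[k]`

Machine half and assembly of the **Amplification Lemma** for private-coin interactive proofs
(Goldwasser–Sipser, STOC 1986, §4.2, p. 65: "Let `p(n)` be a polynomial. Let `V` be a verifier
which on inputs of length `n` [exchanges] a total of at most `g(n)` messages … with error
probability at most `1/3`. Then there is a `V'` such that `L(V) = L(V')`, with a total of at most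
`g(n)` messages, … and with an error probability of at most `2^{-p(n)}`. proof: `V'` performs
`O(p(n))` independent parallel simulations of `V` and takes the majority vote of the outcomes.
Details left to the reader"; Goldreich, *Foundations of Cryptography* I, Prop. 4.2.7 with Ch. 4
Exercise 1), over the tree's `IPVerifier` / `IPRounds` (`InteractiveProofs.lean`), the game layer
`PCGame` (`PrivateCoinGames.lean`, bridge `IPVerifier.game` of `InteractiveProofValues.lean`) and
its threshold repetition `PCGame.threshPar` (`PrivateCoinGamesParallel.lean`):

* `IPRoundsErr k e` — `IP[k]` with two-sided error `e(n)` (`IPRounds_eq_IPRoundsErr_third`,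
  `IPRoundsErr_mono`, `IPRoundsErr_subset_IPRounds`);
* the verifier `IPPar.parVerifier V T Θ` (`T·coins` coins, messages of length `T·msgLen`): its
  next-message function `IPPar.nextPar` and verdict `IPPar.verdictPar` are written in the `FP`
  brick algebra (`FoldBricks.foldLoop` over the boards; board `i`'s view `IPPar.viewBlkF` cuts
  block `i` out of the coins and out of every message with `Boards.mapTakeF ∘ Boards.mapDropF`;
  `padTakeFn`, `umulFn`, `lenBinF`, `UnLe`), with `parVerifier_isPolyTime` and the semantics
  `nextPar_view` (concatenation of the old messages on the boards), `countF_view`,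
  `view_mem_verdictPar_iff` (at least `Θ(|x|)` boards accept);
* blocks and tuples: `flatten_ofFn_block`, `eq_of_block_eq`, `tupleVecEquiv`
  (`(Fin t → {0,1}^m) ≃ {0,1}^{t·m}`), and **the identification of games** `game_par_next` /
  `game_par_accept`: through `tupleVecEquiv` the game of `parVerifier V T Θ` on `x` (coins
  `{0,1}^{t·c}`, messages `{0,1}^{t·m}`) IS `PCGame.threshPar` of the game of `V` — so
  `PCGame.opt_map_equiv` / `play_map_equiv` move the counts across; `parProver` (the `IPProver`
  playing the product strategy, `stratOf_parProver`);
* **`IPRounds_subset_IPRoundsErr_exp`**: `IP[k] ⊆ IPRoundsErr k (exp(-q(n)))` for every round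
  function `k` and polynomial `q` (`18 q(n) + 18` boards, threshold `9 q(n) + 9`; completeness by
  `parProver` and `PCGame.mul_bernoulliProb_le_card_accept_prodStrategy`, soundness against every
  prover by `PCGame.opt_threshPar_nil_le_mul_bernoulliProb`, tails by Hoeffding),
  `IPk_subset_IPRoundsErr_exp`, and the printed form `IPRounds_subset_IPRoundsErr_two_pow`
  (`2^{-q(n)}`).

## References

* S. Goldwasser, M. Sipser, *Private coins versus public coins in interactive proof systems*,
  STOC 1986, 59–68, §4.2, Amplification Lemma (p. 65).
* O. Goldreich, *Foundations of Cryptography I: Basic Tools*, CUP 2001, Def. 4.2.6, Prop. 4.2.7,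
  Ch. 4 Exercise 1.
* S. Arora, B. Barak, *Computational Complexity: A Modern Approach*, CUP 2009, Def. 8.6, §8.1.1
  (error reduction; §1.3 for bounded loops in polynomial time).
-/

noncomputable section

namespace Literature.Computability.Complexity

open _root_.Computability Finset Brick Plumb Polynomial HashBricks Kannan

open scoped Classical

/-! ### The class `IP[k]` with a prescribed error bound -/

/-- **`IPRoundsErr k e`**: languages having a probabilistic polynomial-time verifier that proves
membership within `k(|x|)` messages with *error* `e(|x|)` on both sides: completeness
`x ∈ L ⇒ ∃ P, Pr[accept] ≥ 1 - e(|x|)`, soundness `x ∉ L ⇒ ∀ P, Pr[accept] ≤ e(|x|)`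
(GS86: "`V` has error probability `e`"; Goldreich Def. 4.2.6 with `c = 1 - e`, `s = e`).
[cite: GoldwasserSipser1986, §3 (p. 63)] [cite: Goldreich2001FoC1, Def. 4.2.6] -/
def IPRoundsErr (k : ℕ → ℕ) (e : ℕ → ℝ) : Set (Language Bool) :=
  {L | ∃ V : IPVerifier, V.IsPolyTime ∧ ∀ x : List Bool,
    (x ∈ L → ∃ P : IPProver, 1 - e x.length ≤ V.acceptProb (k x.length) x P) ∧
      (x ∉ L → ∀ P : IPProver, V.acceptProb (k x.length) x P ≤ e x.length)}

/-- Unfolding lemma for `IPRoundsErr`. [folklore] -/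
theorem mem_IPRoundsErr_iff {k : ℕ → ℕ} {e : ℕ → ℝ} {L : Language Bool} :
    L ∈ IPRoundsErr k e ↔ ∃ V : IPVerifier, V.IsPolyTime ∧ ∀ x : List Bool,
      (x ∈ L → ∃ P : IPProver, 1 - e x.length ≤ V.acceptProb (k x.length) x P) ∧
        (x ∉ L → ∀ P : IPProver, V.acceptProb (k x.length) x P ≤ e x.length) :=
  Iff.rfl

/-- Error `1/3` is the standard class: `IP[k] = IPRoundsErr k (1/3)`. [cite: AroraBarakCC2009, Def. 8.6] -/
theorem IPRounds_eq_IPRoundsErr_third (k : ℕ → ℕ) : IPRounds k = IPRoundsErr k fun _ => 1 / 3 := by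
  ext L
  rw [mem_IPRounds_iff, mem_IPRoundsErr_iff]
  refine exists_congr fun V => and_congr Iff.rfl (forall_congr' fun x => and_congr ?_ Iff.rfl)
  constructor
  · rintro h hx; obtain ⟨P, hP⟩ := h hx; exact ⟨P, by linarith⟩
  · rintro h hx; obtain ⟨P, hP⟩ := h hx; exact ⟨P, by linarith⟩

/-- A smaller error bound gives a smaller class. [folklore] -/
theorem IPRoundsErr_mono (k : ℕ → ℕ) {e e' : ℕ → ℝ} (h : ∀ n, e n ≤ e' n) : IPRoundsErr k e ⊆ IPRoundsErr k e' := by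
  rintro L ⟨V, hV, hL⟩
  refine ⟨V, hV, fun x => ⟨fun hx => ?_, fun hx P => ((hL x).2 hx P).trans (h _)⟩⟩
  obtain ⟨P, hP⟩ := (hL x).1 hx
  exact ⟨P, by linarith [h x.length]⟩

/-! ### The parallel-repetition verifier in the brick algebra -/

namespace IPPar

variable (V : IPVerifier) (T Θ : Polynomial ℕ)

/-! Arguments of the piece functions: `z = ⟨x₀, 1ⁱ⟩` with the loop context `x₀ = ⟨w, 1^m⟩` and the
view `w = ⟨x, ⟨R, ⟨1^{|S|}, encList S⟩⟩⟩`. -/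

/-- The view `w` inside a piece argument. [folklore] -/
def viewF : List Bool → List Bool := fstF ∘ fstF
/-- The input `x`. [folklore] -/
def inpF : List Bool → List Bool := fstF ∘ viewF
/-- `1^c`, `c = coins(|x|)`. [folklore] -/
def cU : List Bool → List Bool := polyFn V.coins ∘ inpF
/-- `1^m`, `m = msgLen(|x|)`. [folklore] -/
def mU : List Bool → List Bool := polyFn V.msgLen ∘ inpF
/-- Board `i`'s coins: block `i` of length `c` of `R`. [folklore] -/
def blkR : List Bool → List Bool :=
  takeFn ∘ fanoutFn (cU V) (dropFn ∘ fanoutFn (umulFn ∘ fanoutFn sndF (cU V)) (nthF 1 ∘ viewF))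
/-- Board `i`'s messages: block `i` of length `m` of every message (a coded list). [folklore] -/
def blkS : List Bool → List Bool :=
  Boards.mapTakeF ∘ fanoutFn (mU V) (Boards.mapDropF ∘ fanoutFn (umulFn ∘ fanoutFn sndF (mU V)) (sndPow 2 ∘ viewF))
/-- **Board `i`'s view** `⟨x, ⟨R↾ᵢ, ⟨1^{|S|}, encList (S↾ᵢ)⟩⟩⟩`. [cite: GoldwasserSipser1986, §4.2 (Amplification Lemma)] -/
def viewBlkF : List Bool → List Bool :=
  fanoutFn (inpF) (fanoutFn (blkR V) (fanoutFn (nthF 2 ∘ viewF) (blkS V)))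
/-- The old verifier's message on board `i`, normalised to length `m`. [folklore] -/
def pieceF : List Bool → List Bool := fstF ∘ padTakeFn ∘ fanoutFn (mU V) (V.next ∘ viewBlkF V)
/-- The old verifier's vote on board `i` (one bit). [folklore] -/
def voteF : List Bool → List Bool := (fun v => encodeBool (V.verdict.boolIndicator v)) ∘ viewBlkF V
/-- The initial loop record `⟨⟨w, 1^m⟩, ⟨bin t, ⟨ε, ε⟩⟩⟩` (`t = T(|x|)` rounds to run; the pad
`1^m` makes every piece short relative to the context). [folklore] -/
def initF : List Bool → List Bool :=
  fanoutFn (fanoutFn id (polyFn V.msgLen ∘ fstF))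
    (fanoutFn (lenBinF ∘ polyFn T ∘ fstF) (fanoutFn (fun _ => []) (fun _ => [])))
/-- **The new verifier's next message**: the concatenation over the boards of the old messages.
[cite: GoldwasserSipser1986, §4.2 (Amplification Lemma)] -/
def nextPar : List Bool → List Bool := sndPow 2 ∘ foldLoop appF (clipF 1 (pieceF V)) T ∘ initF V T
/-- The number of accepting boards, in binary. [folklore] -/
def countF : List Bool → List Bool := sndPow 2 ∘ foldLoop addFn (clipF 1 (voteF V)) T ∘ initF V T
/-- **The new verifier's verdict**: at least `Θ(|x|)` boards accept. [cite: GoldwasserSipser1986, §4.2 (Amplification Lemma)] -/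
def verdictPar : Language Bool := (fanoutFn (polyFn Θ ∘ fstF) (countF V T)) ⁻¹' UnLe
/-- **The parallel-repetition verifier** `V^T` with threshold `Θ`: `T·coins` coins, messages of
length `T·msgLen`. [cite: GoldwasserSipser1986, §4.2 (Amplification Lemma)] -/
def parVerifier : IPVerifier := ⟨T * V.coins, T * V.msgLen, nextPar V T, verdictPar V T Θ⟩

/-! ### Field lemmas and polynomial time -/

/-- The fields of `parVerifier` (rewriting lemmas; never unfold by `rfl` against brick terms). [folklore] -/
theorem parVerifier_next : (parVerifier V T Θ).next = nextPar V T := by simp only [parVerifier]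
/-- The fields of `parVerifier`. [folklore] -/
theorem parVerifier_verdict : (parVerifier V T Θ).verdict = verdictPar V T Θ := by simp only [parVerifier]
/-- The fields of `parVerifier`. [folklore] -/
theorem parVerifier_coins (n : ℕ) : (parVerifier V T Θ).coins.eval n = T.eval n * V.coins.eval n := by
  simp only [parVerifier, eval_mul]
/-- The fields of `parVerifier`. [folklore] -/
theorem parVerifier_msgLen (n : ℕ) : (parVerifier V T Θ).msgLen.eval n = T.eval n * V.msgLen.eval n := by
  simp only [parVerifier, eval_mul]

/-- `viewF ∈ FP`. [folklore] -/
theorem viewF_mem_FP : viewF ∈ FP := comp_mem_FP fstF_mem_FP fstF_mem_FP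
/-- `inpF ∈ FP`. [folklore] -/
theorem inpF_mem_FP : inpF ∈ FP := comp_mem_FP fstF_mem_FP viewF_mem_FP
/-- `cU ∈ FP`. [folklore] -/
theorem cU_mem_FP : cU V ∈ FP := comp_mem_FP (polyFn_mem_FP _) inpF_mem_FP
/-- `mU ∈ FP`. [folklore] -/
theorem mU_mem_FP : mU V ∈ FP := comp_mem_FP (polyFn_mem_FP _) inpF_mem_FP
/-- `blkR ∈ FP`. [folklore] -/
theorem blkR_mem_FP : blkR V ∈ FP :=
  comp_mem_FP takeFn_mem_FP (fanoutFn_mem_FP (cU_mem_FP V) (comp_mem_FP dropFn_mem_FP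
    (fanoutFn_mem_FP (comp_mem_FP umulFn_mem_FP (fanoutFn_mem_FP sndF_mem_FP (cU_mem_FP V)))
      (comp_mem_FP (nthF_mem_FP 1) viewF_mem_FP))))
/-- `blkS ∈ FP`. [folklore] -/
theorem blkS_mem_FP : blkS V ∈ FP :=
  comp_mem_FP Boards.mapTakeF_mem_FP (fanoutFn_mem_FP (mU_mem_FP V) (comp_mem_FP Boards.mapDropF_mem_FP
    (fanoutFn_mem_FP (comp_mem_FP umulFn_mem_FP (fanoutFn_mem_FP sndF_mem_FP (mU_mem_FP V)))
      (comp_mem_FP (sndPow_mem_FP 2) viewF_mem_FP))))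
/-- `viewBlkF ∈ FP`. [folklore] -/
theorem viewBlkF_mem_FP : viewBlkF V ∈ FP :=
  fanoutFn_mem_FP inpF_mem_FP (fanoutFn_mem_FP (blkR_mem_FP V) (fanoutFn_mem_FP
    (comp_mem_FP (nthF_mem_FP 2) viewF_mem_FP) (blkS_mem_FP V)))

variable {V}

/-- `pieceF ∈ FP` for a polynomial-time `V`. [folklore] -/
theorem pieceF_mem_FP (hV : V.IsPolyTime) : pieceF V ∈ FP :=
  comp_mem_FP fstF_mem_FP (comp_mem_FP padTakeFn_mem_FP (fanoutFn_mem_FP (mU_mem_FP V)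
    (comp_mem_FP hV.1 (viewBlkF_mem_FP V))))

/-- `voteF ∈ FP` for a polynomial-time `V`. [folklore] -/
theorem voteF_mem_FP (hV : V.IsPolyTime) : voteF V ∈ FP :=
  comp_mem_FP (indicatorFn_mem_FP hV.2) (viewBlkF_mem_FP V)

variable (V)

/-- `initF ∈ FP`. [folklore] -/
theorem initF_mem_FP : initF V T ∈ FP :=
  fanoutFn_mem_FP (fanoutFn_mem_FP (PolyTimeComputable.id _) (comp_mem_FP (polyFn_mem_FP _) fstF_mem_FP))
    (fanoutFn_mem_FP (comp_mem_FP lenBinF_mem_FP (comp_mem_FP (polyFn_mem_FP _) fstF_mem_FP))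
      (fanoutFn_mem_FP (const_mem_FP []) (const_mem_FP [])))

variable {V}

/-- **`nextPar ∈ FP`.** [cite: GoldwasserSipser1986, §4.2 (Amplification Lemma)] -/
theorem nextPar_mem_FP (hV : V.IsPolyTime) : nextPar V T ∈ FP :=
  comp_mem_FP (sndPow_mem_FP 2) (comp_mem_FP
    (foldLoop_clipF_mem_FP 1 appF_mem_FP length_appF_le (pieceF_mem_FP hV) T) (initF_mem_FP V T))

/-- `countF ∈ FP`. [folklore] -/
theorem countF_mem_FP (hV : V.IsPolyTime) : countF V T ∈ FP :=
  comp_mem_FP (sndPow_mem_FP 2) (comp_mem_FP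
    (foldLoop_clipF_mem_FP 1 addFn_mem_FP length_addFn_le (voteF_mem_FP hV) T) (initF_mem_FP V T))

/-- **`verdictPar ∈ P`.** [cite: GoldwasserSipser1986, §4.2 (Amplification Lemma)] -/
theorem verdictPar_mem_P (hV : V.IsPolyTime) : verdictPar V T Θ ∈ Classes.P :=
  preimage_mem_P UnLe_mem_P (fanoutFn_mem_FP (comp_mem_FP (polyFn_mem_FP _) fstF_mem_FP) (countF_mem_FP T hV))

/-- **The parallel-repetition verifier is polynomial-time.** [cite: GoldwasserSipser1986, §4.2 (Amplification Lemma)] -/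
theorem parVerifier_isPolyTime (hV : V.IsPolyTime) : (parVerifier V T Θ).IsPolyTime := by
  refine ⟨?_, ?_⟩
  · rw [parVerifier_next]; exact nextPar_mem_FP T hV
  · rw [parVerifier_verdict]; exact verdictPar_mem_P T Θ hV

/-! ### Semantics on views -/

section Semantics

variable (V : IPVerifier) (T Θ : Polynomial ℕ) (x R : List Bool) (S : List (List Bool))

/-- The view, spelled out: `⟨x, ⟨R, ⟨1^{|S|}, encList S⟩⟩⟩`. [folklore] -/
theorem view_eq : IPVerifier.view x R S = boolPair x (boolPair R (boolPair (ones S.length) (encList S))) := by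
  rw [IPVerifier.view, ← Boards.encMoves_eq]

/-- The loop context `x₀ = ⟨view, 1^m⟩`. [folklore] -/
def ctx : List Bool := boolPair (IPVerifier.view x R S) (ones (V.msgLen.eval x.length))

/-- The context is at least as long as the input and as a message. [folklore] -/
theorem le_length_ctx : x.length ≤ (ctx V x R S).length ∧ V.msgLen.eval x.length ≤ (ctx V x R S).length := by
  rw [ctx, view_eq, length_boolPair, length_boolPair]
  simp only [List.length_replicate]
  omega

/-- `ccat` is the concatenation of the list of pieces. [folklore] -/
theorem ccat_eq_flatten_ofFn (g : ℕ → List Bool) : ∀ n : ℕ, ccat g n = (List.ofFn fun j : Fin n => g j).flatten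
  | 0 => rfl
  | n + 1 => by
    rw [ccat_succ, ccat_eq_flatten_ofFn g n, List.ofFn_succ', List.concat_eq_append, List.flatten_append,
      List.flatten_singleton]
    rfl

/-- **Board `i`'s view is computed by `viewBlkF`.** [cite: GoldwasserSipser1986, §4.2 (Amplification Lemma)] -/
theorem viewBlkF_apply (i : ℕ) :
    viewBlkF V (boolPair (ctx V x R S) (ones i)) =
      IPVerifier.view x (block (V.coins.eval x.length) i R) (S.map (block (V.msgLen.eval x.length) i)) := by
  rw [view_eq x (block _ i R), ctx, view_eq]
  simp [viewBlkF, inpF, viewF, cU, mU, blkR, blkS, nthF, sndPow, block, List.map_map, Function.comp_def]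
  rfl

/-- The piece on board `i`: the old verifier's message there, normalised to length `m`. [folklore] -/
theorem pieceF_apply (i : ℕ) :
    pieceF V (boolPair (ctx V x R S) (ones i)) =
      (V.next (IPVerifier.view x (block (V.coins.eval x.length) i R)
        (S.map (block (V.msgLen.eval x.length) i)))).takeD (V.msgLen.eval x.length) false := by
  have hm : mU V (boolPair (ctx V x R S) (ones i)) = ones (V.msgLen.eval x.length) := by
    rw [ctx, view_eq]; simp [mU, inpF, viewF]
  simp only [pieceF, Function.comp_apply, fanoutFn_apply, hm, viewBlkF_apply, padTakeFn_boolPair, fstF_boolPair,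
    List.length_replicate]

/-- The vote on board `i`. [folklore] -/
theorem voteF_apply (i : ℕ) :
    voteF V (boolPair (ctx V x R S) (ones i)) =
      encodeBool (V.verdict.boolIndicator (IPVerifier.view x (block (V.coins.eval x.length) i R)
        (S.map (block (V.msgLen.eval x.length) i)))) := by
  simp only [voteF, Function.comp_apply, viewBlkF_apply]

/-- The initial record. [folklore] -/
theorem initF_apply : initF V T (IPVerifier.view x R S) =
    boolPair (ctx V x R S) (boolPair (encodeNat (T.eval x.length)) (boolPair (ones 0) [])) := by
  have hx : fstF (IPVerifier.view x R S) = x := by rw [view_eq, fstF_boolPair]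
  simp only [initF, fanoutFn_apply, Function.comp_apply, id, hx, polyFn_apply, lenBinF_apply, List.length_replicate, ctx]
  rfl

/-- **The new verifier's message is the concatenation of the old messages on the boards.**
[cite: GoldwasserSipser1986, §4.2 (Amplification Lemma)] -/
theorem nextPar_view : nextPar V T (IPVerifier.view x R S) =
    ccat (fun j => (V.next (IPVerifier.view x (block (V.coins.eval x.length) j R)
      (S.map (block (V.msgLen.eval x.length) j)))).takeD (V.msgLen.eval x.length) false) (T.eval x.length) := by
  have hk : T.eval x.length ≤ T.eval (fstF (boolPair (ctx V x R S)
      (boolPair (encodeNat (T.eval x.length)) (boolPair (ones 0) [])))).length := by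
    rw [fstF_boolPair]; exact TM2Iter.eval_mono T (le_length_ctx V x R S).1
  rw [nextPar, Function.comp_apply, Function.comp_apply, initF_apply, foldLoop,
    iterate_loopStep _ _ (T.eval x.length) _ _ hk, loopModel_foldBody]
  simp only [sndPow, Function.comp_apply, sndF_boolPair, Nat.zero_add]
  rw [foldAcc_clipF (fun j _ _ => by
    rw [pieceF_apply, List.takeD_length, one_mul]
    exact (le_length_ctx V x R S).2.trans (Nat.le_succ _)), foldAcc_appF, List.nil_append]
  exact ccat_congr fun j _ => by rw [Nat.zero_add, pieceF_apply]

/-- **The number of accepting boards is computed by `countF`.** [folklore] -/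
theorem countF_view : countF V T (IPVerifier.view x R S) =
    encodeNat ((univ.filter fun i : Fin (T.eval x.length) =>
      IPVerifier.view x (block (V.coins.eval x.length) i R) (S.map (block (V.msgLen.eval x.length) i)) ∈
        V.verdict).card) := by
  have hk : T.eval x.length ≤ T.eval (fstF (boolPair (ctx V x R S)
      (boolPair (encodeNat (T.eval x.length)) (boolPair (ones 0) [])))).length := by
    rw [fstF_boolPair]; exact TM2Iter.eval_mono T (le_length_ctx V x R S).1
  rw [countF, Function.comp_apply, Function.comp_apply, initF_apply, foldLoop,
    iterate_loopStep _ _ (T.eval x.length) _ _ hk, loopModel_foldBody]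
  simp only [sndPow, Function.comp_apply, sndF_boolPair, Nat.zero_add]
  rw [foldAcc_clipF (fun j _ _ => by
    rw [voteF_apply, one_mul]
    simp [encodeBool]), show ([] : List Bool) = encodeNat 0 from rfl, foldAcc_addFn, Nat.zero_add]
  congr 1
  simp only [Nat.zero_add, voteF_apply, Boards.bitsToNat_encodeBool]
  rw [← Fin.sum_univ_eq_sum_range (fun j => if V.verdict.boolIndicator (IPVerifier.view x
    (block (V.coins.eval x.length) j R) (S.map (block (V.msgLen.eval x.length) j))) = true then 1 else 0),
    sum_boole]
  exact congrArg Finset.card (filter_congr fun (i : Fin (T.eval x.length)) _ =>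
    (Set.mem_iff_boolIndicator (V.verdict : Set (List Bool)) (IPVerifier.view x
      (block (V.coins.eval x.length) (i : ℕ) R) (S.map (block (V.msgLen.eval x.length) (i : ℕ))))).symm)

/-- **The new verdict: at least `Θ(|x|)` boards accept.** [cite: GoldwasserSipser1986, §4.2 (Amplification Lemma)] -/
theorem view_mem_verdictPar_iff : IPVerifier.view x R S ∈ verdictPar V T Θ ↔
    Θ.eval x.length ≤ (univ.filter fun i : Fin (T.eval x.length) =>
      IPVerifier.view x (block (V.coins.eval x.length) i R) (S.map (block (V.msgLen.eval x.length) i)) ∈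
        V.verdict).card := by
  have hx : fstF (IPVerifier.view x R S) = x := by rw [view_eq, fstF_boolPair]
  change fanoutFn (polyFn Θ ∘ fstF) (countF V T) (IPVerifier.view x R S) ∈ UnLe ↔ _
  rw [fanoutFn_apply, boolPair_mem_UnLe, countF_view, bitsToNat_encodeNat,
    Function.comp_apply, hx, polyFn_apply, List.length_replicate]

end Semantics

end IPPar

/-! ### Strings of `t` blocks -/

section Blocks

/-- The blocks of a concatenation of `t` strings of length `m` are the strings. [folklore] -/
theorem block_flatten_ofFn {t m : ℕ} : ∀ (w : Fin t → List Bool), (∀ i, (w i).length = m) →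
    ∀ i : Fin t, block m i (List.ofFn w).flatten = w i
  | w, hw, i => by
    induction t with
    | zero => exact i.elim0
    | succ t ih =>
      rw [List.ofFn_succ, List.flatten_cons]
      refine Fin.cases ?_ (fun j => ?_) i
      · show ((w 0 ++ (List.ofFn fun i => w i.succ).flatten).drop (0 * m)).take m = w 0
        rw [Nat.zero_mul, List.drop_zero, List.take_append_of_le_length (hw 0).ge, ← hw 0, List.take_length]
      · have h := ih (fun i => w i.succ) (fun i => hw i.succ) j
        show ((w 0 ++ (List.ofFn fun i => w i.succ).flatten).drop ((j.succ : ℕ) * m)).take m = w j.succ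
        rw [← h]
        show _ = (((List.ofFn fun i => w i.succ).flatten).drop ((j : ℕ) * m)).take m
        rw [Fin.val_succ, Nat.succ_mul, Nat.add_comm, ← List.drop_drop, ← hw 0, List.drop_left]

/-- The length of a concatenation of `t` strings of length `m`. [folklore] -/
theorem length_flatten_ofFn {t m : ℕ} (w : Fin t → List Bool) (hw : ∀ i, (w i).length = m) :
    (List.ofFn w).flatten.length = t * m := by
  rw [List.length_flatten, List.map_ofFn, List.sum_ofFn]
  simp [hw]

/-- **A string of length `t·m` is the concatenation of its `t` blocks.** [folklore] -/
theorem flatten_ofFn_block {m : ℕ} : ∀ {t : ℕ} (w : List Bool), w.length = t * m →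
    (List.ofFn fun i : Fin t => block m i w).flatten = w
  | 0, w, hw => by rw [Nat.zero_mul, List.length_eq_zero_iff] at hw; subst hw; rfl
  | t + 1, w, hw => by
    have h1 : (w.drop m).length = t * m := by rw [List.length_drop, hw, Nat.succ_mul]; omega
    have ih := flatten_ofFn_block (w.drop m) h1
    rw [List.ofFn_succ, List.flatten_cons]
    have hb0 : block m ((0 : Fin (t + 1)) : ℕ) w = w.take m := by simp [block]
    have hbs : ∀ j : Fin t, block m ((j.succ : Fin (t + 1)) : ℕ) w = block m j (w.drop m) := fun j => by
      simp only [block, Fin.val_succ, Nat.succ_mul, List.drop_drop]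
      congr 2; ring
    rw [hb0]
    conv_rhs => rw [← List.take_append_drop m w, ← ih]
    rw [show (fun i : Fin t => block m ((i.succ : Fin (t + 1)) : ℕ) w) = fun j : Fin t => block m (j : ℕ) (w.drop m) from
      _root_.funext hbs]

/-- Two strings of length `t·m` with the same blocks are equal. [folklore] -/
theorem eq_of_block_eq {t m : ℕ} {u v : List Bool} (hu : u.length = t * m) (hv : v.length = t * m)
    (h : ∀ i : Fin t, block m i u = block m i v) : u = v := by
  rw [← flatten_ofFn_block u hu, ← flatten_ofFn_block v hv]
  congr 2
  exact _root_.funext h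

/-- **Tuples of vectors as one long vector** (`(Fin t → {0,1}^m) ≃ {0,1}^{t·m}`, block `i` = component
`i`): the message and coin equivalences identifying the repeated verifier's game with
`PCGame.threshPar`. [folklore] -/
def tupleVecEquiv (t m : ℕ) : (Fin t → List.Vector Bool m) ≃ List.Vector Bool (t * m) :=
  ((Equiv.piCongrRight fun _ => Equiv.vectorEquivFin Bool m).trans (Blocks.tupleEquiv t m)).trans
    (Equiv.vectorEquivFin Bool (t * m)).symm

/-- Block `i` of the long vector is component `i`. [folklore] -/
theorem block_tupleVecEquiv {t m : ℕ} (f : Fin t → List.Vector Bool m) (i : Fin t) :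
    block m i (tupleVecEquiv t m f).toList = (f i).toList := by
  have h1 : (tupleVecEquiv t m f).toList = List.ofFn (Blocks.tupleEquiv t m fun j => (f j).get) := by
    simp only [tupleVecEquiv, Equiv.trans_apply, Equiv.vectorEquivFin, Equiv.coe_fn_symm_mk,
      Equiv.piCongrRight, Equiv.coe_fn_mk, List.Vector.toList_ofFn]
    rfl
  have h2 := block_ofFn_tupleEquiv_append (fun j => (f j).get) [] i
  rw [List.append_nil] at h2
  rw [h1, h2, ← List.Vector.toList_ofFn, List.Vector.ofFn_get]

end Blocks

/-! ### The repeated verifier's game is `threshPar` of the verifier's game -/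

section Game

variable (V : IPVerifier) (T Θ : Polynomial ℕ) (x : List Bool)

/-- Blocks of the history read through the message equivalence are the components' histories. [folklore] -/
theorem map_block_map_tupleVecEquiv {t m : ℕ} (h : List (Fin t → List.Vector Bool m)) (i : Fin t) :
    ((h.map (tupleVecEquiv t m)).map List.Vector.toList).map (block m i) =
      (h.map (· i)).map List.Vector.toList := by
  rw [List.map_map, List.map_map, List.map_map]
  exact List.map_congr_left fun a _ => block_tupleVecEquiv a i

/-- **The next message of the repeated verifier's game is the tuple of the components' next
messages.** [cite: GoldwasserSipser1986, §4.2 (Amplification Lemma)] -/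
theorem game_par_next (r : Fin (T.eval x.length) → List.Vector Bool (V.coins.eval x.length))
    (h : List (Fin (T.eval x.length) → List.Vector Bool (V.msgLen.eval x.length))) :
    ((IPPar.parVerifier V T Θ).game x (T.eval x.length * V.msgLen.eval x.length)
        (T.eval x.length * V.coins.eval x.length)).next
        (tupleVecEquiv _ _ r) (h.map (tupleVecEquiv _ _)) =
      tupleVecEquiv _ _ (((V.game x (V.msgLen.eval x.length) (V.coins.eval x.length)).threshPar
        (T.eval x.length) (Θ.eval x.length)).next r h) := by
  refine List.Vector.eq _ _ ?_
  rw [IPVerifier.toList_game_next, IPVerifier.vmsg, IPPar.parVerifier_next, IPPar.nextPar_view, IPPar.ccat_eq_flatten_ofFn]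
  have hlen := length_flatten_ofFn (fun j : Fin (T.eval x.length) => (V.next (IPVerifier.view x
      (block (V.coins.eval x.length) (j : ℕ) (tupleVecEquiv _ _ r).toList)
      (((h.map (tupleVecEquiv _ _)).map List.Vector.toList).map (block (V.msgLen.eval x.length) (j : ℕ))))).takeD
      (V.msgLen.eval x.length) false) fun _ => List.takeD_length _ _ _
  rw [IPVerifier.takeD_of_length_eq _ hlen]
  refine eq_of_block_eq hlen (List.Vector.toList_length _) fun i => ?_
  rw [block_flatten_ofFn _ (fun _ => List.takeD_length _ _ _) i, block_tupleVecEquiv, block_tupleVecEquiv,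
    map_block_map_tupleVecEquiv]
  rfl

/-- **The verdict of the repeated verifier's game is the threshold of the components' verdicts.**
[cite: GoldwasserSipser1986, §4.2 (Amplification Lemma)] -/
theorem game_par_accept (r : Fin (T.eval x.length) → List.Vector Bool (V.coins.eval x.length))
    (h : List (Fin (T.eval x.length) → List.Vector Bool (V.msgLen.eval x.length))) :
    ((IPPar.parVerifier V T Θ).game x (T.eval x.length * V.msgLen.eval x.length)
        (T.eval x.length * V.coins.eval x.length)).accept
        (tupleVecEquiv _ _ r) (h.map (tupleVecEquiv _ _)) ↔
      ((V.game x (V.msgLen.eval x.length) (V.coins.eval x.length)).threshPar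
        (T.eval x.length) (Θ.eval x.length)).accept r h := by
  rw [IPVerifier.game_accept_iff, IPPar.parVerifier_verdict, IPPar.view_mem_verdictPar_iff, PCGame.threshPar_accept_iff]
  refine (congrArg (fun s : Finset (Fin (T.eval x.length)) => Θ.eval x.length ≤ s.card)
    (filter_congr fun i _ => ?_)).to_iff
  rw [IPVerifier.game_accept_iff, block_tupleVecEquiv, map_block_map_tupleVecEquiv]

/-- **The parallel prover** of the repetition realising the product strategy: answer on every
block as `P` would on that block alone. [cite: GoldwasserSipser1986, §4.2 (Amplification Lemma)] -/
def parProver (P : IPProver) (t m : ℕ) : IPProver := fun S =>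
  (List.ofFn fun i : Fin t => (P (S.map (block m i))).takeD m false).flatten

/-- The parallel prover's strategy is the product strategy, read through the message equivalence.
[folklore] -/
theorem stratOf_parProver (P : IPProver) (t m : ℕ) :
    IPVerifier.stratOf (t * m) (parProver P t m) =
      fun h' => tupleVecEquiv t m (PCGame.prodStrategy (IPVerifier.stratOf m P) t (h'.map (tupleVecEquiv t m).symm)) := by
  funext h'
  obtain ⟨h, rfl⟩ : ∃ h, h' = h.map (tupleVecEquiv t m) :=
    ⟨h'.map (tupleVecEquiv t m).symm, by rw [List.map_map, Equiv.self_comp_symm, List.map_id]⟩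
  rw [List.map_map, Equiv.symm_comp_self, List.map_id]
  refine List.Vector.eq _ _ ?_
  have hlen : (parProver P t m ((h.map (tupleVecEquiv t m)).map List.Vector.toList)).length = t * m :=
    length_flatten_ofFn _ fun _ => List.takeD_length _ _ _
  show (parProver P t m ((h.map (tupleVecEquiv t m)).map List.Vector.toList)).takeD (t * m) false = _
  rw [IPVerifier.takeD_of_length_eq _ hlen]
  refine eq_of_block_eq hlen (List.Vector.toList_length _) fun i => ?_
  rw [parProver, block_flatten_ofFn _ (fun _ => List.takeD_length _ _ _) i, block_tupleVecEquiv,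
    map_block_map_tupleVecEquiv]
  rfl

end Game

/-! ### Error reduction for `IP[k]` (GS86 Amplification Lemma; Goldreich, FoC Prop. 4.2.7) -/

section Amplification

/-- The threshold polynomial `Θ = 9q + 9` of the error reduction to `exp(-q)`. [folklore] -/
def thrPoly (q : Polynomial ℕ) : Polynomial ℕ := 9 * q + 9

/-- The board-count polynomial `T = 2Θ = 18q + 18`. [folklore] -/
def cntPoly (q : Polynomial ℕ) : Polynomial ℕ := 2 * thrPoly q

/-- Value of `thrPoly`. [folklore] -/
theorem thrPoly_eval (q : Polynomial ℕ) (n : ℕ) : (thrPoly q).eval n = 9 * q.eval n + 9 := by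
  simp [thrPoly]

/-- Value of `cntPoly`. [folklore] -/
theorem cntPoly_eval (q : Polynomial ℕ) (n : ℕ) : (cntPoly q).eval n = 2 * (thrPoly q).eval n := by
  simp [cntPoly]

/-- **Acceptance probabilities are counts in the game** at any names `N = coins(|x|)`,
`Mm = msgLen(|x|)` of the lengths (the bridge `IPVerifier.cnt_accepts_eq` of
`InteractiveProofValues.lean`, restated so that the repeated verifier's lengths `t·c`, `t·m` can be
used as indices). [cite: AroraBarakCC2009, Def. 8.6] -/
theorem acceptProb_eq_card_game (W : IPVerifier) (x : List Bool) (k : ℕ) (Q : IPProver) {N Mm : ℕ}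
    (hN : W.coins.eval x.length = N) (hM : W.msgLen.eval x.length = Mm) :
    W.acceptProb k x Q = ((univ.filter fun v : List.Vector Bool N =>
      (W.game x Mm N).accept v ((W.game x Mm N).transcript k v (IPVerifier.stratOf Mm Q))).card : ℝ) / 2 ^ N := by
  subst hN hM
  unfold IPVerifier.acceptProb
  rw [uniformProb_eq_cnt_div, W.cnt_accepts_eq k x Q]

/-- **Error reduction for `IP[k]` by parallel repetition (Goldwasser–Sipser's Amplification
Lemma; Goldreich, FoC Prop. 4.2.7 (1 ⇒ 2) with Exercise 4.1).** For every round function `k` and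
every polynomial `q`, a language with a `k`-message interactive proof of error `1/3` has a
`k`-message interactive proof of error `≤ exp(-q(n))`: run `18 q(n) + 18` copies in parallel on
independent coins and accept iff at least `9 q(n) + 9` of them accept. Completeness by the parallel
prover `parProver` (the product strategy), soundness against ALL provers of the parallel system (who
may correlate the copies) by `PCGame.opt_threshPar_nil_le_mul_bernoulliProb`, the tails by
Hoeffding's inequality. GS86 state the lemma with error `2^{-p(n)}` and "Details left to the reader";
Goldreich leaves it as an exercise ("do not assume that the cheating prover executes each copy
independently of the other copies").
[cite: GoldwasserSipser1986, §4.2 (Amplification Lemma, p. 65)] [cite: Goldreich2001FoC1, Prop. 4.2.7 and Ch. 4 Ex. 1] -/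
theorem IPRounds_subset_IPRoundsErr_exp (k : ℕ → ℕ) (q : Polynomial ℕ) :
    IPRounds k ⊆ IPRoundsErr k (fun n => Real.exp (-((q.eval n : ℕ) : ℝ))) := by
  rintro L ⟨V, hV, hL⟩
  refine ⟨IPPar.parVerifier V (cntPoly q) (thrPoly q), IPPar.parVerifier_isPolyTime _ _ hV, fun x => ?_⟩
  set n := x.length with hn
  set t := (cntPoly q).eval n with ht
  set θ := (thrPoly q).eval n with hθ
  set c := V.coins.eval n with hc
  set m := V.msgLen.eval n with hm
  have htθ : t = 2 * θ := by rw [ht, hθ, cntPoly_eval]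
  have ht0 : 0 < t := by rw [htθ, hθ, thrPoly_eval]; omega
  have ht2 : (t : ℝ) ≤ 2 * θ := by rw [htθ]; push_cast; exact le_rfl
  have ht1 : 2 * θ ≤ t + 1 := by omega
  have hexp_le : Real.exp (-(t : ℝ) / 18) ≤ Real.exp (-((q.eval n : ℕ) : ℝ)) := by
    refine Real.exp_le_exp.2 ?_
    have : (t : ℝ) = 18 * (q.eval n + 1) := by rw [htθ, hθ, thrPoly_eval]; push_cast; ring
    rw [this]; linarith
  have h2c : (0 : ℝ) < 2 ^ c := by positivity
  have hpow : (2 : ℝ) ^ (t * c) = ((2 : ℝ) ^ c) ^ t := by rw [mul_comm, pow_mul]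
  have hcardR : (Fintype.card (List.Vector Bool c) : ℝ) = 2 ^ c := by rw [card_vector, Fintype.card_bool]; push_cast; rfl
  -- the two games and their identification
  set G := (V.game x m c).threshPar t θ with hG
  set G' := (IPPar.parVerifier V (cntPoly q) (thrPoly q)).game x (t * m) (t * c) with hG'
  have hnext : ∀ r h, G'.next (tupleVecEquiv t c r) (h.map (tupleVecEquiv t m)) = tupleVecEquiv t m (G.next r h) :=
    game_par_next V (cntPoly q) (thrPoly q) x
  have hacc : ∀ r h, G'.accept (tupleVecEquiv t c r) (h.map (tupleVecEquiv t m)) ↔ G.accept r h :=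
    game_par_accept V (cntPoly q) (thrPoly q) x
  refine ⟨fun hx => ?_, fun hx Q => ?_⟩
  · -- completeness: the parallel prover
    obtain ⟨P, hPacc⟩ := (hL x).1 hx
    refine ⟨parProver P t m, ?_⟩
    set σ := IPVerifier.stratOf m P with hσ
    have hcount : (1 - 1 / 3 : ℝ) * Fintype.card (List.Vector Bool c) ≤
        ((univ.filter fun r : List.Vector Bool c => (V.game x m c).accept r ((V.game x m c).transcript (k n) r σ)).card : ℝ) := by
      have h1 : (2 / 3 : ℝ) ≤ (cnt c {r | V.Accepts (k n) x r P} : ℝ) / 2 ^ c := by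
        have := hPacc; unfold IPVerifier.acceptProb at this; rwa [uniformProb_eq_cnt_div] at this
      rw [le_div_iff₀ h2c, V.cnt_accepts_eq (k n) x P] at h1
      rw [hcardR]; linarith
    have hcomp := (V.game x m c).mul_bernoulliProb_le_card_accept_prodStrategy t θ (k n) (by norm_num : (1 / 3 : ℝ) ≤ 1) σ hcount
    have htail := one_sub_bernoulliProb_atLeast_le_exp (t := t) (θ := θ) (by norm_num : (0 : ℝ) ≤ 1 / 3) le_rfl ht0 ht1
    -- the accepted joint coins of `parProver` are those of the product strategy
    have hcard : ((univ.filter fun v : List.Vector Bool (t * c) =>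
        G'.accept v (G'.transcript (k n) v (IPVerifier.stratOf (t * m) (parProver P t m)))).card : ℝ) =
        ((univ.filter fun r : Fin t → List.Vector Bool c =>
          G.accept r (G.transcript (k n) r (PCGame.prodStrategy σ t))).card : ℝ) := by
      rw [stratOf_parProver]
      refine congrArg Nat.cast (card_equiv (tupleVecEquiv t c) fun r => ?_).symm
      simp only [mem_filter, mem_univ, true_and, PCGame.transcript]
      have hp := PCGame.play_map_equiv G G' (tupleVecEquiv t c) (tupleVecEquiv t m) hnext r (PCGame.prodStrategy σ t) (k n) []
      rw [List.map_nil] at hp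
      rw [hp, hacc]
    rw [acceptProb_eq_card_game _ x (k n) _ (IPPar.parVerifier_coins V _ _ n) (IPPar.parVerifier_msgLen V _ _ n), hcard, hpow,
      le_div_iff₀ (by positivity)]
    rw [hcardR] at hcomp
    have h3 : (1 - Real.exp (-((q.eval n : ℕ) : ℝ))) * ((2 : ℝ) ^ c) ^ t ≤
        ((2 : ℝ) ^ c) ^ t * bernoulliProb (AtLeast t θ) (fun _ => 1 - 1 / 3) := by
      rw [mul_comm]
      exact mul_le_mul_of_nonneg_left (by linarith) (by positivity)
    exact h3.trans hcomp
  · -- soundness: every prover of the parallel system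
    have hs : ((V.game x m c).opt (k n) [] : ℝ) ≤ 1 / 3 * Fintype.card (List.Vector Bool c) := by
      rw [hcardR]; exact V.optAccept_le_mul_two_pow ((hL x).2 hx)
    have hsound := (V.game x m c).opt_threshPar_nil_le_mul_bernoulliProb t θ (k n) (by norm_num : (0 : ℝ) ≤ 1 / 3)
      (by norm_num : (1 / 3 : ℝ) ≤ 1) hs
    have htail := bernoulliProb_atLeast_le_exp (t := t) (θ := θ) (by norm_num : (0 : ℝ) ≤ 1 / 3) le_rfl ht0 ht2
    have hopt : ((univ.filter fun v : List.Vector Bool (t * c) =>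
        G'.accept v (G'.transcript (k n) v (IPVerifier.stratOf (t * m) Q))).card : ℝ) ≤ G.opt (k n) [] := by
      have h1 := G'.card_accept_transcript_le_opt (IPVerifier.stratOf (t * m) Q) (k n)
      have h2 : G'.opt (k n) [] = G.opt (k n) [] := by
        have := PCGame.opt_map_equiv G G' (tupleVecEquiv t c) (tupleVecEquiv t m) hnext hacc (k n) []
        rwa [List.map_nil] at this
      exact_mod_cast h2 ▸ h1
    rw [acceptProb_eq_card_game _ x (k n) _ (IPPar.parVerifier_coins V _ _ n) (IPPar.parVerifier_msgLen V _ _ n), hpow,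
      div_le_iff₀ (by positivity)]
    rw [hcardR] at hsound
    refine (hopt.trans hsound).trans ?_
    rw [mul_comm]
    exact mul_le_mul_of_nonneg_right (htail.trans hexp_le) (by positivity)

/-- **Error reduction for `IP[k]`, constant `k`.** [cite: GoldwasserSipser1986, §4.2 (Amplification Lemma)] -/
theorem IPk_subset_IPRoundsErr_exp (k : ℕ) (q : Polynomial ℕ) :
    IPk k ⊆ IPRoundsErr (fun _ => k) (fun n => Real.exp (-((q.eval n : ℕ) : ℝ))) :=
  IPRounds_subset_IPRoundsErr_exp _ q

/-- **Error reduction to `2^{-q(n)}`** (the form stated by Goldwasser–Sipser and Goldreich).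
[cite: GoldwasserSipser1986, §4.2 (Amplification Lemma)] [cite: Goldreich2001FoC1, Prop. 4.2.7] -/
theorem IPRounds_subset_IPRoundsErr_two_pow (k : ℕ → ℕ) (q : Polynomial ℕ) :
    IPRounds k ⊆ IPRoundsErr k (fun n => (1 / 2 : ℝ) ^ q.eval n) := by
  refine (IPRounds_subset_IPRoundsErr_exp k q).trans (IPRoundsErr_mono k fun n => ?_)
  rw [← Real.rpow_natCast, show (1 / 2 : ℝ) = Real.exp (-Real.log 2) by
    rw [Real.exp_neg, Real.exp_log (by norm_num)]; norm_num, ← Real.exp_mul]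
  refine Real.exp_le_exp.2 ?_
  have hlog : Real.log 2 ≤ 1 := by
    have := Real.log_le_sub_one_of_pos (by norm_num : (0 : ℝ) < 2); linarith
  nlinarith [Nat.cast_nonneg (α := ℝ) (q.eval n)]

/-- Conversely a smaller error is still an interactive proof: `IPRoundsErr k e ⊆ IP[k]` for
`e ≤ 1/3`. [cite: AroraBarakCC2009, Def. 8.6] -/
theorem IPRoundsErr_subset_IPRounds (k : ℕ → ℕ) {e : ℕ → ℝ} (he : ∀ n, e n ≤ 1 / 3) :
    IPRoundsErr k e ⊆ IPRounds k := by
  rw [IPRounds_eq_IPRoundsErr_third]; exact IPRoundsErr_mono k he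

end Amplification


end Literature.Computability.Complexity

end
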